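import Literature.NumberTheory.Automorphic.CuspidalContragredientInvolution
import Literature.NumberTheory.Automorphic.AutomorphicFormsKTranslates
import HarnessLib

/-!
# The contragredient on `GL_n(𝔸_K)`: archimedean calculus under `φ ↦ φ ∘ τ`

Topic `NumberTheory/Automorphic`. Proofs-only support file (theorems, no definitions, no named
facts), second of the series `CuspidalContragredient{Involution, Arch, Forms, Hecke, Proofs}`
discharging `CuspidalAutomorphicRepData.exists_contragredient_satake` (`CuspidalContragredient`):
the contragredient of a cuspidal automorphic representation of `GL_n(𝔸_K)` in the Borel–Jacquet
datum model is realised on the functions `φ ∘ τ`, `τ(g) = w₀ ᵗg⁻¹ w₀`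
(`weylLong n R * glTransposeInv (Fin n) R g * weylLong n R`; Cogdell 2004, §2).

Here: the archimedean conditions of Borel–Jacquet 1979, §4.2 (b), (c) are transported along `τ`.
The differential of `τ` on `𝔤 = 𝔤𝔩_n(K_∞)` is the involutive Lie algebra automorphism
`θ(X) = -w₀ ᵗX w₀` (`exists_lieHom_neg_weylLong_transpose`; all statements take any `θ` with this
defining property); `τ(exp X) = exp(θ X)`, so `X (φ ∘ τ) = ((θ X) φ) ∘ τ`
(`lieDeriv_comp_weylLong_mul_glTransposeInv_mul_weylLong`), the word action substitutes `θ`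
(`applyFree_comp_…`), `U(θ)` preserves the centre `Z(𝔤)` (`isCentralWord_lift_lieHom_of_involutive`,
as `isCentralWord_lift_Ad` of `AutomorphicFormsKTranslates`), whence `Z(𝔤)`-finiteness,
`K_∞`-finiteness (`τ(K_∞) = K_∞`) and archimedean smoothness of `φ ∘ τ`
(`IsZFinite/IsKFinite/IsArchSmooth.comp_weylLong_mul_glTransposeInv_mul_weylLong`).

## References

* A. Borel, H. Jacquet, *Automorphic forms and automorphic representations*, PSPM 33.1 (1979),
  §1.1–1.6, §4.2. [BorelJacquetCorvallis1979]
* J. W. Cogdell, *Analytic theory of L-functions for GL_n*, in: An Introduction to the Langlands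
  Program, Birkhäuser 2004, §2. [CogdellAnalyticTheory2004]
-/

noncomputable section

open scoped MatrixGroups Matrix NNReal Classical ContDiff
open NumberField IsDedekindDomain

namespace Literature.NumberTheory.Automorphic

open GaloisRepresentations (glTransposeInv coe_glTransposeInv_apply)

/-! ### The archimedean calculus under `g ↦ w₀ ᵗg⁻¹ w₀` -/

section Arch

-- Mathlib idiom (Mathlib/Algebra/Lie/OfAssociative.lean), as in `RealMatrixGroups`, `AutomorphicForms`:
-- the commutator Lie ring on matrices, needed to mention the Lie algebra of the archimedean group.
attribute [local instance 100] LieRing.ofAssociativeRing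

variable {n : ℕ} {K : Type} [Field K] [NumberField K] {hcpt : isCompact_glFiniteIntegralLevel n K}

local notation "𝕂∞" => mixedEmbedding.mixedSpace K
local notation "𝒟" => AutomorphyDatum.gl n K hcpt
local notation "τ∞[" g "]" => weylLong n (mixedEmbedding.mixedSpace K) *
  glTransposeInv (Fin n) (mixedEmbedding.mixedSpace K) g * weylLong n (mixedEmbedding.mixedSpace K)
local notation "τ𝔸[" g "]" => weylLong n (AdeleRing (𝓞 K) K) *
  glTransposeInv (Fin n) (AdeleRing (𝓞 K) K) g * weylLong n (AdeleRing (𝓞 K) K)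
-- precomposition with `τ` as a linear endomorphism of the functions on `GL_n(𝔸_K)`
set_option quotPrecheck false in
local notation "τ𝔸⋆" => LinearMap.funLeft ℂ ℂ (m := (AdelicGroupData.gl n K).Adelic)
  (n := (AdelicGroupData.gl n K).Adelic) fun g => τ𝔸[g]

/-- `(w₀ w₀ : M_n) = 1` at the matrix level. [folklore] -/
theorem coe_weylLong_mul_coe_weylLong {R : Type*} [CommRing R] :
    ((weylLong n R : GL (Fin n) R) : Matrix (Fin n) (Fin n) R) * (weylLong n R : GL (Fin n) R) = 1 := by
  rw [← Units.val_mul, weylLong_mul_self, Units.val_one]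

/-- `w₀` is symmetric: `ᵗw₀ = w₀`. [folklore] -/
theorem transpose_coe_weylLong {R : Type*} [CommRing R] :
    ((weylLong n R : GL (Fin n) R) : Matrix (Fin n) (Fin n) R)ᵀ = (weylLong n R : GL (Fin n) R) := by
  rw [coe_weylLong, Matrix.transpose_permMatrix, Equiv.Perm.inv_def, Fin.revPerm_symm]

/-- `τ` is multiplicative on `GL_n(𝔸_K)` (the group law of the adelic datum). [folklore] -/
theorem weylLong_mul_glTransposeInv_mul_weylLong_mul_adelic (g h : (AdelicGroupData.gl n K).Adelic) :
    τ𝔸[g * h] = τ𝔸[g] * τ𝔸[h] :=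
  weylLong_mul_glTransposeInv_mul_weylLong_mul g h

/-- **The differential `θ(X) = -w₀ ᵗX w₀` of `g ↦ w₀ ᵗg⁻¹ w₀`** is a homomorphism of the real Lie
algebra `𝔤 = 𝔤𝔩_n(K_∞)` of the archimedean group of the `GL_n` datum (minus the transpose is a
Lie algebra automorphism, and so is conjugation by `w₀`): existence as a `LieHom`. [folklore] -/
theorem exists_lieHom_neg_weylLong_transpose :
    ∃ θ : (𝒟).arch.lie →ₗ⁅ℝ⁆ (𝒟).arch.lie, ∀ X : (𝒟).arch.lie,
      ((θ X : (𝒟).arch.lie) : Matrix (Fin n) (Fin n) 𝕂∞) =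
        -(((weylLong n 𝕂∞ : GL (Fin n) 𝕂∞) : Matrix (Fin n) (Fin n) 𝕂∞) *
          (X : Matrix (Fin n) (Fin n) 𝕂∞)ᵀ * ((weylLong n 𝕂∞ : GL (Fin n) 𝕂∞) : Matrix (Fin n) (Fin n) 𝕂∞)) := by
  set w : Matrix (Fin n) (Fin n) 𝕂∞ := ((weylLong n 𝕂∞ : GL (Fin n) 𝕂∞) : Matrix (Fin n) (Fin n) 𝕂∞)
    with hw
  have hww : ∀ M : Matrix (Fin n) (Fin n) 𝕂∞, w * (w * M) = M := fun M => by
    rw [← Matrix.mul_assoc, hw, coe_weylLong_mul_coe_weylLong, Matrix.one_mul]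
  refine ⟨{ toFun := fun X => ⟨-(w * (X : Matrix (Fin n) (Fin n) 𝕂∞)ᵀ * w),
              (LieSubalgebra.mem_top _ : _ ∈ (archGroupGL n K).lie)⟩
            map_add' := fun X Y => ?_
            map_smul' := fun c X => ?_
            map_lie' := fun {X Y} => ?_ }, fun X => rfl⟩
  · refine Subtype.ext ?_
    change -(w * ((X : Matrix (Fin n) (Fin n) 𝕂∞) + (Y : Matrix (Fin n) (Fin n) 𝕂∞))ᵀ * w) =
      -(w * (X : Matrix (Fin n) (Fin n) 𝕂∞)ᵀ * w) + -(w * (Y : Matrix (Fin n) (Fin n) 𝕂∞)ᵀ * w)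
    rw [Matrix.transpose_add, Matrix.mul_add, Matrix.add_mul, neg_add]
  · refine Subtype.ext ?_
    change -(w * ((c • (X : Matrix (Fin n) (Fin n) 𝕂∞)))ᵀ * w) =
      c • -(w * (X : Matrix (Fin n) (Fin n) 𝕂∞)ᵀ * w)
    rw [Matrix.transpose_smul, Matrix.mul_smul, Matrix.smul_mul, smul_neg]
  · refine Subtype.ext ?_
    rw [LieSubalgebra.coe_bracket]
    change -(w * (⁅(X : Matrix (Fin n) (Fin n) 𝕂∞), (Y : Matrix (Fin n) (Fin n) 𝕂∞)⁆)ᵀ * w) =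
      ⁅-(w * (X : Matrix (Fin n) (Fin n) 𝕂∞)ᵀ * w), -(w * (Y : Matrix (Fin n) (Fin n) 𝕂∞)ᵀ * w)⁆
    rw [LieRing.of_associative_ring_bracket, LieRing.of_associative_ring_bracket, Matrix.transpose_sub,
      Matrix.transpose_mul, Matrix.transpose_mul, neg_mul_neg, neg_mul_neg]
    simp only [Matrix.mul_sub, Matrix.sub_mul, Matrix.mul_assoc, hww, neg_sub]

variable (θ : (AutomorphyDatum.gl n K hcpt).arch.lie →ₗ⁅ℝ⁆ (AutomorphyDatum.gl n K hcpt).arch.lie)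
  (hθ : ∀ X : (AutomorphyDatum.gl n K hcpt).arch.lie,
    ((θ X : (AutomorphyDatum.gl n K hcpt).arch.lie) :
        Matrix (Fin n) (Fin n) (mixedEmbedding.mixedSpace K)) =
      -(((weylLong n (mixedEmbedding.mixedSpace K) : GL (Fin n) (mixedEmbedding.mixedSpace K)) :
          Matrix (Fin n) (Fin n) (mixedEmbedding.mixedSpace K)) *
        (X : Matrix (Fin n) (Fin n) (mixedEmbedding.mixedSpace K))ᵀ *
        ((weylLong n (mixedEmbedding.mixedSpace K) : GL (Fin n) (mixedEmbedding.mixedSpace K)) :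
          Matrix (Fin n) (Fin n) (mixedEmbedding.mixedSpace K))))

include hθ in
/-- `θ` is an involution: `θ (θ X) = X` (`ᵗw₀ = w₀`, `w₀² = 1`). [folklore] -/
theorem lieHom_neg_weylLong_transpose_involutive (X : (𝒟).arch.lie) : θ (θ X) = X := by
  refine Subtype.ext ?_
  rw [hθ, hθ, Matrix.transpose_neg, Matrix.transpose_mul, Matrix.transpose_mul,
    Matrix.transpose_transpose, transpose_coe_weylLong, Matrix.mul_neg, Matrix.neg_mul, neg_neg,
    ← Matrix.mul_assoc, ← Matrix.mul_assoc, coe_weylLong_mul_coe_weylLong, Matrix.one_mul,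
    Matrix.mul_assoc, coe_weylLong_mul_coe_weylLong, Matrix.mul_one]

include hθ in
/-- **`τ(exp X) = exp (θ X)`**: one-parameter subgroups of `GL_n(K_∞)` under `g ↦ w₀ ᵗg⁻¹ w₀`
(`ᵗ(exp X)⁻¹ = exp(-ᵗX)` and `w₀ exp(Y) w₀ = exp(w₀ Y w₀)`). [folklore] -/
theorem weylLong_mul_glTransposeInv_mul_weylLong_expMem (X : (𝒟).arch.lie) :
    τ∞[((𝒟).arch.expMem X : GL (Fin n) 𝕂∞)] = ((𝒟).arch.expMem (θ X) : GL (Fin n) 𝕂∞) := by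
  refine Units.ext ?_
  rw [Units.val_mul, Units.val_mul, coe_glTransposeInv_apply, RealMatrixGroup.coe_expMem,
    RealMatrixGroup.coe_expMem, ← expGL_neg, coe_expGL, coe_expGL, hθ, ← Matrix.exp_transpose,
    Matrix.transpose_neg]
  have h := Matrix.exp_units_conj (weylLong n 𝕂∞) (-(X : Matrix (Fin n) (Fin n) 𝕂∞)ᵀ)
  rw [weylLong_inv] at h
  rw [← h, Matrix.mul_neg, Matrix.neg_mul]

include hθ in
/-- `τ (ofArch (exp X)) = ofArch (exp (θ X))` in `GL_n(𝔸_K)`. [folklore] -/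
theorem weylLong_mul_glTransposeInv_mul_weylLong_ofArch_expMem (X : (𝒟).arch.lie) :
    τ𝔸[(𝒟).ofArch ((𝒟).arch.expMem X)] = (𝒟).ofArch ((𝒟).arch.expMem (θ X)) := by
  rw [AutomorphyDatum.gl_ofArch_apply, AutomorphyDatum.gl_ofArch_apply,
    weylLong_mul_glTransposeInv_mul_weylLong_ofInfinite]
  exact congrArg (GLn.ofInfinite n K) (weylLong_mul_glTransposeInv_mul_weylLong_expMem θ hθ X)

include hθ in
/-- **Lie derivatives of `φ ∘ τ`**: `X (φ ∘ τ) = ((θ X) φ) ∘ τ` (exact, including junk values).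
Borel–Jacquet 1979, §1.5. [folklore] -/
theorem lieDeriv_comp_weylLong_mul_glTransposeInv_mul_weylLong (X : (𝒟).arch.lie)
    (φ : (AdelicGroupData.gl n K).Adelic → ℂ) :
    lieDeriv (𝒟).ofArch X (fun g => φ (τ𝔸[g])) = fun g => lieDeriv (𝒟).ofArch (θ X) φ (τ𝔸[g]) := by
  funext g
  simp only [lieDeriv]
  congr 1
  funext t
  rw [weylLong_mul_glTransposeInv_mul_weylLong_mul_adelic,
    weylLong_mul_glTransposeInv_mul_weylLong_ofArch_expMem θ hθ, map_smul]
  rfl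

include hθ in
/-- Iterated Lie derivatives of `φ ∘ τ`: `X₁ ⋯ X_k (φ ∘ τ) = ((θ X₁) ⋯ (θ X_k) φ) ∘ τ`. [folklore] -/
theorem iterLieDeriv_comp_weylLong_mul_glTransposeInv_mul_weylLong (w : List (𝒟).arch.lie)
    (φ : (AdelicGroupData.gl n K).Adelic → ℂ) :
    iterLieDeriv (𝒟).ofArch w (fun g => φ (τ𝔸[g])) =
      fun g => iterLieDeriv (𝒟).ofArch (w.map θ) φ (τ𝔸[g]) := by
  induction w with
  | nil => rfl
  | cons X w ih =>
    rw [List.map_cons, iterLieDeriv_cons, iterLieDeriv_cons, ih]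
    exact lieDeriv_comp_weylLong_mul_glTransposeInv_mul_weylLong θ hθ X _

include hθ in
/-- **The word action on `φ ∘ τ`**: `p (φ ∘ τ) = ((θ · p) φ) ∘ τ`, where `θ · p` substitutes `θ X`
for each letter `X` of `p`. Borel–Jacquet 1979, §1.5–1.6. [folklore] -/
theorem applyFree_comp_weylLong_mul_glTransposeInv_mul_weylLong (p : FreeAlgebra ℝ (𝒟).arch.lie)
    (φ : (AdelicGroupData.gl n K).Adelic → ℂ) :
    applyFree (𝒟).ofArch p (fun g => φ (τ𝔸[g])) =
      fun g => applyFree (𝒟).ofArch (FreeAlgebra.lift ℝ (FreeAlgebra.ι ℝ ∘ θ) p) φ (τ𝔸[g]) := by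
  have hR : ∀ ψ : (AdelicGroupData.gl n K).Adelic → ℂ, (fun g => ψ (τ𝔸[g])) = τ𝔸⋆ ψ :=
    fun ψ => rfl
  conv_rhs => rw [applyFree_lift_comp, hR, map_finsuppSum]
  unfold applyFree
  refine Finsupp.sum_congr fun w _ => ?_
  rw [map_smul, ← hR, iterLieDeriv_comp_weylLong_mul_glTransposeInv_mul_weylLong θ hθ]

/-- Substitution by a Lie algebra homomorphism `e` on words covers `U(e)` on `U(𝔤)`:
`freeToEnveloping (e · p) = U(e) (freeToEnveloping p)` (as `freeToEnveloping_lift_Ad`). [folklore] -/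
theorem freeToEnveloping_lift_lieHom {A : Type*} [NormedCommRing A] [NormedAlgebra ℝ A] [NormedAlgebra ℚ A]
    [CompleteSpace A] [StarRing A] {N : Type*} [Fintype N] [DecidableEq N] {H : RealMatrixGroup A N}
    (e : H.lie →ₗ⁅ℝ⁆ H.lie) (p : FreeAlgebra ℝ H.lie) :
    freeToEnveloping H (FreeAlgebra.lift ℝ (FreeAlgebra.ι ℝ ∘ e) p) =
      UniversalEnvelopingAlgebra.lift ℝ ((UniversalEnvelopingAlgebra.ι ℝ).comp e)
        (freeToEnveloping H p) := by
  change ((freeToEnveloping H).comp (FreeAlgebra.lift ℝ (FreeAlgebra.ι ℝ ∘ e))) p =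
    ((UniversalEnvelopingAlgebra.lift ℝ ((UniversalEnvelopingAlgebra.ι ℝ).comp e)).comp
      (freeToEnveloping H)) p
  congr 1
  refine FreeAlgebra.hom_ext ?_
  funext X
  simp [freeToEnveloping]

/-- **An involutive Lie algebra homomorphism maps central words to central words**: `U(e)` is an
algebra automorphism of `U(𝔤)` (its own inverse) and preserves the centre `Z(𝔤)` (as
`isCentralWord_lift_Ad`). Borel–Jacquet 1979, §1.6. [folklore] -/
theorem isCentralWord_lift_lieHom_of_involutive {A : Type*} [NormedCommRing A] [NormedAlgebra ℝ A]
    [NormedAlgebra ℚ A] [CompleteSpace A] [StarRing A] {N : Type*} [Fintype N] [DecidableEq N]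
    {H : RealMatrixGroup A N} (e : H.lie →ₗ⁅ℝ⁆ H.lie) (he : ∀ X, e (e X) = X)
    {p : FreeAlgebra ℝ H.lie} (hp : IsCentralWord p) :
    IsCentralWord (FreeAlgebra.lift ℝ (FreeAlgebra.ι ℝ ∘ e) p) := by
  unfold IsCentralWord at hp ⊢
  rw [freeToEnveloping_lift_lieHom]
  set Ue := UniversalEnvelopingAlgebra.lift ℝ ((UniversalEnvelopingAlgebra.ι ℝ).comp e) with hUe
  have hcomp : Ue.comp Ue = AlgHom.id ℝ _ := by
    refine UniversalEnvelopingAlgebra.hom_ext (h := LieHom.ext fun X => ?_)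
    simp [hUe, he]
  have hinv : ∀ y, Ue (Ue y) = y := fun y => by
    change (Ue.comp Ue) y = y
    rw [hcomp]
    rfl
  rw [Subalgebra.mem_center_iff] at hp ⊢
  intro y
  rw [← hinv y, ← map_mul, hp (Ue y), map_mul]

include hθ in
/-- **The `Z(𝔤)`-orbit span of `φ ∘ τ`** is contained in the `(· ∘ τ)`-image of that of `φ`.
Borel–Jacquet 1979, §1.6. [folklore] -/
theorem zOrbitSpan_comp_weylLong_mul_glTransposeInv_mul_weylLong_le
    (φ : (AdelicGroupData.gl n K).Adelic → ℂ) :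
    zOrbitSpan (𝒟).ofArch (fun g => φ (τ𝔸[g])) ≤
      (zOrbitSpan (𝒟).ofArch φ).map
        τ𝔸⋆ := by
  refine Submodule.span_le.mpr ?_
  rintro _ ⟨p, hp, rfl⟩
  rw [SetLike.mem_coe, applyFree_comp_weylLong_mul_glTransposeInv_mul_weylLong θ hθ]
  exact Submodule.mem_map_of_mem (Submodule.subset_span
    ⟨_, isCentralWord_lift_lieHom_of_involutive θ
      (lieHom_neg_weylLong_transpose_involutive θ hθ) hp, rfl⟩)

include hθ in
/-- **`Z(𝔤)`-finiteness is preserved by `φ ↦ φ ∘ τ`.** Borel–Jacquet 1979, §1.6 and §4.2(c). [folklore] -/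
theorem IsZFinite.comp_weylLong_mul_glTransposeInv_mul_weylLong
    {φ : (AdelicGroupData.gl n K).Adelic → ℂ} (hφ : IsZFinite (𝒟).ofArch φ) :
    IsZFinite (𝒟).ofArch (fun g => φ (τ𝔸[g])) := by
  unfold IsZFinite at hφ ⊢
  haveI := hφ
  exact Submodule.finiteDimensional_of_le
    (zOrbitSpan_comp_weylLong_mul_glTransposeInv_mul_weylLong_le θ hθ φ)

/-- Right archimedean translates of `φ ∘ τ`: `r(h) (φ ∘ τ) = (r(τ h) φ) ∘ τ`. [folklore] -/
theorem archTranslate_comp_weylLong_mul_glTransposeInv_mul_weylLong (h : (𝒟).arch.carrier)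
    (φ : (AdelicGroupData.gl n K).Adelic → ℂ) :
    archTranslate (𝒟).ofArch h (fun g => φ (τ𝔸[g])) =
      fun g => archTranslate (𝒟).ofArch
        ⟨τ∞[(h : GL (Fin n) 𝕂∞)], (Subgroup.mem_top _ : _ ∈ (archGroupGL n K).carrier)⟩ φ (τ𝔸[g]) := by
  funext g
  rw [archTranslate_apply, archTranslate_apply, weylLong_mul_glTransposeInv_mul_weylLong_mul_adelic,
    AutomorphyDatum.gl_ofArch_apply, AutomorphyDatum.gl_ofArch_apply,
    weylLong_mul_glTransposeInv_mul_weylLong_ofInfinite]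
  rfl

/-- The span of the `K_∞`-translates of `φ ∘ τ` is contained in the `(· ∘ τ)`-image of that of `φ`
(`τ(K_∞) = K_∞`). Borel–Jacquet 1979, §1.3. [folklore] -/
theorem kTranslateSpan_comp_weylLong_mul_glTransposeInv_mul_weylLong_le
    (φ : (AdelicGroupData.gl n K).Adelic → ℂ) :
    kTranslateSpan (𝒟).ofArch (fun g => φ (τ𝔸[g])) ≤
      (kTranslateSpan (𝒟).ofArch φ).map
        τ𝔸⋆ := by
  refine Submodule.span_le.mpr ?_
  rintro _ ⟨k, rfl⟩
  rw [SetLike.mem_coe]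
  dsimp only
  rw [archTranslate_comp_weylLong_mul_glTransposeInv_mul_weylLong]
  have hk : τ∞[((k : (𝒟).arch.maximalCompact) : GL (Fin n) 𝕂∞)] ∈ Kinf n K :=
    weylLong_mul_glTransposeInv_mul_weylLong_mem_Kinf (AutomorphyDatum.gl_arch_maximalCompact n K hcpt ▸ k.2)
  exact Submodule.mem_map_of_mem (archTranslate_mem_kTranslateSpan _ ⟨_, hk⟩ φ)

/-- **`K_∞`-finiteness is preserved by `φ ↦ φ ∘ τ`.** Borel–Jacquet 1979, §1.3 and §4.2(b). [folklore] -/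
theorem IsKFinite.comp_weylLong_mul_glTransposeInv_mul_weylLong
    {φ : (AdelicGroupData.gl n K).Adelic → ℂ} (hφ : IsKFinite (𝒟).ofArch φ) :
    IsKFinite (𝒟).ofArch (fun g => φ (τ𝔸[g])) := by
  unfold IsKFinite at hφ ⊢
  haveI := hφ
  exact Submodule.finiteDimensional_of_le
    (kTranslateSpan_comp_weylLong_mul_glTransposeInv_mul_weylLong_le φ)

open scoped Matrix.Norms.Operator in
include hθ in
/-- **Archimedean smoothness is preserved by `φ ↦ φ ∘ τ`**: the slice of `φ ∘ τ` through `g` is the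
slice of `φ` through `τ g` composed with the (continuous, `K_∞` being finite-dimensional) linear map
`θ`. Borel–Jacquet 1979, §1.1 and §4.1. [folklore] -/
theorem IsArchSmooth.comp_weylLong_mul_glTransposeInv_mul_weylLong
    {φ : (AdelicGroupData.gl n K).Adelic → ℂ} (hφ : IsArchSmooth (𝒟).ofArch φ) :
    IsArchSmooth (𝒟).ofArch (fun g => φ (τ𝔸[g])) := by
  intro g
  let L : (𝒟).arch.lie.toSubmodule →ₗ[ℝ] (𝒟).arch.lie.toSubmodule :=
    { toFun := fun X => ⟨(θ ⟨X, X.2⟩ : (𝒟).arch.lie), (θ ⟨X, X.2⟩).2⟩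
      map_add' := fun X Y => by
        ext1
        change ((θ (⟨X, X.2⟩ + ⟨Y, Y.2⟩) : (𝒟).arch.lie) : Matrix (Fin n) (Fin n) 𝕂∞) = _
        rw [map_add]
        rfl
      map_smul' := fun c X => by
        ext1
        change ((θ (c • ⟨X, X.2⟩) : (𝒟).arch.lie) : Matrix (Fin n) (Fin n) 𝕂∞) = _
        rw [map_smul]
        rfl }
  haveI : FiniteDimensional ℝ (𝒟).arch.lie.toSubmodule := inferInstance
  have hLsmooth : ContDiff ℝ ∞ (L : (𝒟).arch.lie.toSubmodule → (𝒟).arch.lie.toSubmodule) :=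
    (⟨L, L.continuous_of_finiteDimensional⟩ :
      (𝒟).arch.lie.toSubmodule →L[ℝ] (𝒟).arch.lie.toSubmodule).contDiff
  set g' : (AdelicGroupData.gl n K).Adelic := τ𝔸[g] with hg'
  have heq : (fun X : (𝒟).arch.lie.toSubmodule =>
      (fun g => φ (τ𝔸[g])) (g * (𝒟).ofArch ((𝒟).arch.expMem ⟨X, X.2⟩))) =
      (fun Y : (𝒟).arch.lie.toSubmodule => φ (g' * (𝒟).ofArch ((𝒟).arch.expMem ⟨Y, Y.2⟩)))
        ∘ (L : _ → _) := by
    funext X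
    simp only [Function.comp_apply]
    rw [weylLong_mul_glTransposeInv_mul_weylLong_mul_adelic,
      weylLong_mul_glTransposeInv_mul_weylLong_ofArch_expMem θ hθ]
    rfl
  rw [heq]
  exact (hφ g').comp hLsmooth

end Arch

end Literature.NumberTheory.Automorphic
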